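import Summits.BirchSwinnertonDyer.BirchSwinnertonDyer.Theses.ByReductionTypeAtTwo
import Summits.BirchSwinnertonDyer.BirchSwinnertonDyer.Theorems.ByReductionTypeAtTwoRankOneAtTwoOffBigImageOddLocalDefs
import Summits.BirchSwinnertonDyer.BirchSwinnertonDyer.Theorems.ByReductionTypeAtTwoRankOneAtTwoOffBigImageOddLocalCellGlue
import HarnessLib

set_option autoImplicit false
set_option linter.dupNamespace false

/-!
# Disproof of `RankOneAtTwoOffBigImageOddLocal` (stmt-BirchSwinnertonDyer-23716) — findings

Seat `refuter-cdisprove-stmt-BirchSwinnertonDyer-23716-g0-0` (crux-disprove with kit, director-bsd MINT RC-262/RC-270,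
2026-08-28).  Line attacked: `refined_kolyvagin_tamagawa_shift_at_two` (LEAD `prover-cruxlead-…-23716-g0`; the 7 registered
stub STATEMENTS are the closed declarations of `Theorems/ByReductionTypeAtTwoRankOneAtTwoOffBigImageOddLocalDefs.lean`,
namespace `…Theorems.OffBigImageOddLocalAtTwo`).  **BSD is not proved by any of this; the crux and all 7 stubs stay OPEN.**

## (0) Verdict shape — no kill of the CRUX is reachable; what is attacked instead
The crux is the β-COMPLEMENT slice of `RankOneAtTwo`: «BSD₂(W) for every globally minimal non-CM `W/ℚ` of analytic rank 1
OFF {`ρ_{W,2^∞}` onto ∧ odd `#E(ℚ)_tors` ∧ odd `∏ c_ℓ`}».  `¬ crux` is «some such curve violates the 2-part of BSD»: no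
instance is known or constructible, and the statement quantifies over NO posited interface (only Mathlib/tree symbols
`HasCM`, `HasSurjectiveModNGaloisRep`, `torsionOrder`, `tamagawaProduct`, `analyticRank`, `BSDp`), so there is no junk
model to instantiate.  Structure audit of the line's vocabulary (junk hunting, all NEGATIVE = no kill):
* `ModularParametrizationData W N` (Literature `ModularCurve.lean`): the constant `c : ℤ` cannot be `0` (`deg_spec` forces
  `φ` non-constant); the scaling `φ ↦ k·φ` (`c ↦ k c`, `deg ↦ k² deg`) IS a legitimate datum, and every stub is written
  scaling-covariantly (`sigmaShift W Dt = v₂ ∏c + v₂ c(Dt)`; door laws carry `2·v₂ c(Dt)`), so scaling kills nothing.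
* `KolyvaginHeegnerData Dt β ι n` (Literature `HeegnerPointsOfConductor.lean`): `y` is pinned by `map_y`, the generators
  `σ_ℓ` by `zpowers_σ`, the transversal `S` by `S_transversal`; for `h_K = 1` and `n = ℓ` prime, `K[1] = K`, `|S| = 1` and
  `derivedPoint = s • D_ℓ y_ℓ` — a Galois translate of Kolyvagin's `P(ℓ)`, so `2^m`-divisibility of `derivedPoint` in
  `E(K[ℓ])` is exactly `P(ℓ) ∈ 2^m E(K[ℓ])`, independent of `s` and (mod `2^{M(ℓ)}`) of the generator
  (`D_{σ^k} ≡ k⁻¹ D_σ (mod 2^M ℤ[G])` for `k` odd, `2^M ∣ ℓ+1`, using `Tr y_ℓ = a_ℓ y_K ≡ 0`).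
* Load-bearing hypotheses of the CRUX (mutation pass): dropping `¬ HasCM`, `analyticRank = 1` or the off-slice
  conjunct each leaves a statement still implied by BSD — no `_false_without_` theorem exists short of a BSD
  counterexample.  Recorded, not typed.

## (1) FIRST TARGET (LEAD's «disprover-wanted»): S3′ `SigmaAccumulationModTwoAtTwo` — Σ-ACCUMULATION at p = 2
S3′ says: for every Kolyvagin-admissible `K`, ANY datum, every square-free product `n` of Kolyvagin primes at 2 and
every `m ≤ min(σ(W,Dt), M(n))`, `P(n) ∈ 2^m E(K[n])`.  In print only for ODD `p` (Jetchev 2008 Thm. 1.4: ONE Tamagawa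
factor, `m_∞ ≥ max_q ord_p c_q`; Burungale–Castella–Grossi–Skinner 2023 Thm. 2: `M_∞ = Σ_q ord_p c_q` for `p > 3` and a
`p`-optimal parametrisation — `p`-optimality is void at `p = 2` on this locus: no rational 2-torsion ⇒ all rational
isogenies odd ⇒ `v₂ c_q`, `v₂ deg` and 2-divisibility depths are isogeny-invariant).  At `p = 2` S3′ is «BSD₂ + the 2-adic
Kolyvagin structure theorem» and is GENUINELY undecided by theory at (a) NON-SHARP primes (`a_ℓ = 0`, `M(ℓ) = v₂(ℓ+1)`:
McCallum's (4.4) needs `2^M ∣ ℓ(ℓ+1)/2·(…)`, valuation only `M−1`) and (b) levels `M(ℓ) = σ`; and Σ-ACCUMULATION proper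
(`m > max_q v₂ c_q`, two even Tamagawa numbers) is open at every `p`, short of BCGS.
ENGINE (Sage 10.9 + PARI 2.17 kit jobs j313777 · j313811 · j314574 · j314793 · j315453 · j315688 (+ replay), each
ONE batched job with MANIFEST + CONTROL IDENTITY; `--workitem` evidence auto-attached): for an optimal rank-1 non-CM
curve `E` with `E(ℚ)[2] = 0` and non-square `Δ` (so `ρ̄_{E,2}` onto), `K = ℚ(√d)` (odd fundamental `d`, class number
`h ≤ 5`) with the Heegner hypothesis and `L(E^d,1) ≠ 0` (buckets G: `= 0`, DEGENERATE `K` — S3′ has no non-degeneracy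
hypothesis), and a Kolyvagin prime `ℓ ∈ {3, 7, 11}` at 2 (`M(ℓ) = v₂ gcd(ℓ+1, a_ℓ) ∈ {2, 3}`, sharp and non-sharp):
  (i) NUMERICS → ALGEBRA: `H(X) = ∏_{g ∈ Gal(K[ℓ]/K)} (X − x(g·y_ℓ)) ∈ K[X]` (degree `h(ℓ+1)`) and
      `y_K = Tr_{K[1]/K} y_1 ∈ E(K)` from the q-series of the optimal parametrisation at the Heegner points of
      conductor `ℓ` (orientation `ℓβ`) / conductor 1, rational reconstruction at `d = 400…2905` digits with ≥ 15 % margin;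
  (ii) EXACT ARITHMETIC in `L = K[ℓ]`, presented SMALL as `polredbest(polclass(ℓ²d)·(y²−d))` (degree `2h(ℓ+1) ≤ 80`):
      `H` splits completely in `L` (independent confirmation of (i)), `y_ℓ ∈ E(L)`, `σ ∈ Gal(L/K[1])` of order `ℓ+1`
      from `nfgaloisconj` (`K[1]` located by the roots of `polclass(d)`), a transversal `S` of `Gal(L/K)/Gal(L/K[1])`,
      the control identity `Σ_{g ∈ Gal(L/K)} g·y_ℓ = a_ℓ · y_K` EXACTLY, `E(L)[2] = 0` (so halves are unique), and the
      exact 2-divisibility depth of `P(ℓ) = Σ_{s∈S} s Σ_{i=1}^{ℓ} i σ^i y_ℓ` by iterated halving (`nfroots` of the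
      halving quartic); the obstruction at the last step is CERTIFIED independently at three primes `r` splitting
      completely in `L` (the obstructing partial sum has no half in `E(𝔽_r)`).  Depth verdicts are independent of the
      choices of root, generator and transversal (they agree mod `2^{M(ℓ)} E(L)` since `2^M ∣ ℓ+1` and `2^M ∣ a_ℓ`).
  (iii) RESIDUES at GENERATOR primes (Frobenius generating `Gal(K[ℓ]/K)`) turned out PROVABLY WEAK — local depth
      exceeds global depth by `≥ v₂(ℓ(ℓ+1)/2)` (`D_Φ` acts on `E[2^k]` through `Σ j = ℓ(ℓ+1)/2`) — and are reported
      only as uninformative upper bounds; no verdict rests on them.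
RESULTS (32 exact instances, table in § Targets): in EVERY instance the depth of `P(ℓ)` is `≥ min(σ, M(ℓ))` — S3′ HOLDS — and equals `σ` wherever measured exactly with
`M(ℓ) ≥ σ` (equality in the stub's own regime); in particular Σ-ACCUMULATION beyond Jetchev's `max` holds at the
LEAD's requested regime: 6413j1 (`c = [4,2]`, `σ = 3 > max = 2`), `K = ℚ(√−43)`, `ℓ = 7` (`a₇ = 0`, level `M = 3`,
non-sharp): depth of `P(7)` in `E(K[7])` is EXACTLY 3 (j314793); and at `σ = 2` two-carrier curves (`c`-2-parts
`[2,2]`, `max = 1`): 1266a1/ℚ(√−23)/ℓ=7 (depth 2 < M = 3: also an S4′ witness), 2074b1/ℚ(√−103), 4216c1/ℚ(√−55),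
4720d1/ℚ(√−31), 3496g1/ℚ(√−79) at ℓ = 3, 3128b1/ℚ(√−15) at sharp ℓ = 7, and the degenerate-`K` two-carrier 5025g1/
ℚ(√−11)/ℓ=7 (depth 2).  NO stub-false witness exists in the computed range; the pattern «depth = σ at non-degenerate K» says the stub is
stated at the right strength in its regime `M(ℓ) ≥ σ` (information for S4′/S5′: stringent primitivity is witnessed at
EVERY instance with `M(ℓ) > σ`), while at primes with `M(ℓ) < σ` the point is MORE divisible than `2^{M}` (4005b1, 5687b1:
`≥ 2^3` at `M = 2`) — harmless for S3′ (an inequality) but a caution for any stub that would read `c_M(ℓ)` off `P(ℓ)` there.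

## (2) Stub-false sweep over the 7 named statements — see `-- Targets`.

## HANDOFF (for the next arming)
Landed under `Theorems/…/Negative/`: nothing (no stub is false in any computed instance; no `¬`-theorem exists).  Sorried
here: nothing.  Engine: work folder `s3job/` (Sage/PARI; modes full/supp/supp2/supp3/pin/replay; class number `h ≤ 6`;
exact stage `global2`).  Next regimes if re-armed: composite `n = ℓ₁ℓ₂` (degree `2h(ℓ₁+1)(ℓ₂+1)` — needs the residue
method at NON-generator primes or p-adic halving), `ℓ = 23/31` (`M = 3…5`), `σ ≥ 4`, and the LEAD's stuck stubs as they
appear.  The generator-prime residue test is provably weak (do not reuse it as a certificate).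
-/

noncomputable section

open scoped Classical

namespace Summit.BirchSwinnertonDyer.BirchSwinnertonDyer.Cruxes.RankOneAtTwoOffBigImageOddLocal.Disproof

open WeierstrassCurve Literature.NumberTheory.EllipticCurves
  Summit.BirchSwinnertonDyer.BirchSwinnertonDyer.Theses.ByReductionTypeAtTwo
  Summit.BirchSwinnertonDyer.BirchSwinnertonDyer.Theorems.OffBigImageOddLocalAtTwo

/-! ## (a) Load-bearing analysis of the crux — the slice algebra (kernel-checked bookkeeping) -/

/-- The crux together with its sibling `RankOneAtTwoBigImageOddLocal` (stmt-…-23715) is EXACTLY the parent `RankOneAtTwo`: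
the two slices are complementary and neither is weaker than the parent on its own half.  (The `→` direction is the
route's glue `RankOneAtTwoGlue`, landed by the planner; this `↔` records that no hypothesis of the crux can be dropped
without re-absorbing the sibling.) -/
theorem rankOneAtTwo_iff_slices :
    RankOneAtTwo ↔ RankOneAtTwoBigImageOddLocal ∧ RankOneAtTwoOffBigImageOddLocal := by
  constructor
  · intro h
    exact ⟨fun W _ _ hCM _ _ _ hr => h W hCM hr, fun W _ _ hCM _ hr => h W hCM hr⟩
  · rintro ⟨hOn, hOff⟩ W _ _ hCM hr
    by_cases hs : (∀ n : ℕ, W.HasSurjectiveModNGaloisRep ((2 ^ n : ℕ) : ℤ)) ∧ Odd W.torsionOrder ∧ Odd W.tamagawaProduct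
    · exact hOn W hCM hs.1 hs.2.1 hs.2.2 hr
    · exact hOff W hCM hs hr

/-- Mutation «drop the off-slice conjunct»: the crux WITHOUT its slice hypothesis is the parent `RankOneAtTwo` itself
(BSD₂ for all non-CM analytic-rank-1 curves) — so `RankOneAtTwoOffBigImageOddLocalWithoutSlice` is BSD-strength and
admits no `_false_without_` theorem short of a BSD counterexample. -/
def RankOneAtTwoOffBigImageOddLocalWithoutSlice : Prop :=
  ∀ (W : WeierstrassCurve ℚ) [W.IsElliptic] [W.IsGloballyMinimal], ¬ W.HasCM → W.analyticRank = 1 →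
    Literature.NumberTheory.EllipticCurves.BSDp W 2

theorem withoutSlice_iff_parent : RankOneAtTwoOffBigImageOddLocalWithoutSlice ↔ RankOneAtTwo := Iff.rfl

/-! ## (c) Filter facts for the line's witness filters (small models of the prime supply) -/

/-- **`a_ℓ = 0` primes are never sharp.**  At a Kolyvagin prime with `a_ℓ = 0` (half of the Kolyvagin primes at `2` of an
S₃-image curve have `ρ̄(Frob_ℓ)` of order 2, and among those `a_ℓ = 0` is the supersingular-type event), `M(ℓ) = v₂(ℓ+1)`
and `2^{M(ℓ)+1} ∤ ℓ + 1`: the `SharpAtTwo` filter of S4′/S5′(Φ) discards them all.  These are exactly the NON-SHARP primes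
of § (1)(a) at which the first target is run (`ℓ = 3, 7` with `a_ℓ = 0`). -/
theorem not_sharpAtTwo_of_frobeniusTrace_eq_zero (W : WeierstrassCurve ℚ) [W.IsGloballyMinimal] {ℓ : ℕ}
    (h : W.frobeniusTrace ℓ = 0) : ¬ SharpAtTwo W ℓ := by
  intro hs
  have h3 := (sharp_exact W hs).2.2
  exact h3 (by rw [h]; exact dvd_zero _)

/-- At an `a_ℓ = 0` prime the Kolyvagin index is the full `2`-adic valuation of `ℓ + 1`. -/
theorem kolyvaginIndex_of_frobeniusTrace_eq_zero (W : WeierstrassCurve ℚ) [W.IsGloballyMinimal] {ℓ : ℕ}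
    (h : W.frobeniusTrace ℓ = 0) : Zhang2014.kolyvaginIndex W 2 ℓ = padicValNat 2 (ℓ + 1) := by
  simp [Zhang2014.kolyvaginIndex, h]

/-! ## (d) Statement hygiene of the door-law stubs S2a′/S2b′ (typed) -/

/-- In `Gamma1OddCDoorIndexLawAtTwo` / `Gamma1EvenCDoorIndexLawAtTwo` the hypothesis `IsSquare W.Δ` (γ₁ habitat) makes the
sign term `[Δ < 0]` of the door law identically `0`: a square is non-negative.  (Dead term, not a defect: the general
`DoorLawCTFor` needs it; recorded so that a prover does not case on it.) -/
theorem discSignTerm_eq_zero_of_isSquare (W : WeierstrassCurve ℚ) (h : IsSquare W.Δ) :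
    (if W.Δ < 0 then 1 else 0 : ℕ) = 0 := by
  obtain ⟨r, hr⟩ := h
  have : ¬ W.Δ < 0 := not_lt.mpr (hr ▸ mul_self_nonneg r)
  simp [this]

-- Targets
/-!
## Targets — the 7 registered stub statements (Defs file @22a1ae39e1714e3d), census of this seat

* `S_print` (S1) — conjunction of audited Literature facts (`S_pub`, `S_pubHL`, Milne 1972 any-model).  Not attacked
  beyond reading: no junk binder found (all three carry `IsGloballyMinimal` / `ShaFinite` guards).  OPEN-as-facts.
* `TwoTorsionHalf` (S7) — BSD₂ for non-CM rank-1 curves WITH rational 2-torsion: BSD-strength, no instance attackable.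
* `Gamma1OddCDoorIndexLawAtTwo` / `Gamma1EvenCDoorIndexLawAtTwo` (S2a′/S2b′) — per-curve BSD₂-EQUIVALENT
  (`bsdp_two_iff_doorLawFullCT_at`); on γ₁ (`Δ ∈ ℚ^{×2}`) the `[Δ<0]` term is identically `0`.  Numerically testable
  only through BSD₂ itself; not attacked.
* `SigmaAccumulationModTwoAtTwo` (S3′) — FIRST TARGET, § (1).  STATEMENT-LEVEL: unlike S4′/S5′, S3′ carries NO
  non-degeneracy hypothesis (`y_K` of infinite order / `L(E^{d_K},1) ≠ 0`); tested on DEGENERATE `K` too (rows marked) —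
  it holds there as well, so no `stub-misstated` note is warranted.  VERDICT OF THIS SEAT: **no counterexample in all 32
  distinct exact instances: depth(P(ℓ)) ≥ min(σ, M(ℓ)), with depth = σ in every non-degenerate row measured exactly** (② = two-carrier rows, i.e. Σ-accumulation beyond
  Jetchev's max, incl. the requested level-3 regime 6413j1/2502i1 with σ = 3 and 1266a1 with σ = 2 < M = 3).
  ADDED (job j317673, engine v3.1): 7579e1/ℚ(√−43)/ℓ=7 (`c = [1,4,2]`, σ = 3, `m_K = 4`): depth EXACTLY 3 (third level-3
  two-carrier σ = 3 instance); 3496a1/ℚ(√−15)/ℓ=7 (`[2,2,1]`, σ = 2 < M = 3): depth 2 (S4′ witness); the SHARP level-2 prime ℓ = 7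
  (`a₇ = −4`, `M = 2`) on the σ = 3 curves 4005b1 (`[2,4,1]`) and 5687b1 (`[4,2]`): depth ≥ 3 (cap) > M — so the exact law is
  NOT `min(σ, M)` but (consistent with every row) **depth = σ whenever measured exactly, and ≥ min(σ,M) always**; the only row
  with depth < σ is the DEGENERATE-`K` row 1346a1 (σ = 3, depth 2 = M(3)).  and a THIRD Kolyvagin prime ℓ = 11 (`a₁₁ = 0`, `M = 2`): 3128b1
  (`[2,2,1]`, σ = 2)/ℚ(√−15): depth EXACTLY 2 in the degree-48 ring class field `K[11]`.

| curve | c_q | σ | max v₂c_q | d_K (h) | ℓ, a_ℓ, M(ℓ) | [K[ℓ]:ℚ] | degenerate K | claim min(σ,M) | EXACT depth of P(ℓ) | S4′ witness (depth=σ<M) | job:case |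
| 2074b1 ② | [2, 2, 1] | 2 | 1 | -103 (5) | 3, 0, 2 (non-sharp) | 40 | no | 2 | **2** (cert primes 991,1327,1951) | — | j315453:T3_2074b1_D103_l3 |
| 3496g1 ② | [2, 1, 2] | 2 | 1 | -79 (5) | 3, 0, 2 (non-sharp) | 40 | no | 2 | **2** (cert primes 811,907,3847) | — | j315688:T3_3496g1_D79_l3 |
| 4216c1 ② | [2, 2, 1] | 2 | 1 | -55 (4) | 3, 0, 2 (non-sharp) | 32 | no | 2 | **2** (cert primes 2269,2341,3631) | — | j315688:T3_4216c1_D55_l3 |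
| 4720d1 ② | [2, 2, 1] | 2 | 1 | -31 (3) | 3, 0, 2 (non-sharp) | 24 | no | 2 | **2** (cert primes 379,1063,1117) | — | j315688:T3_4720d1_D31_l3 |
| 1346a1 | [8, 1] | 3 | 3 | -7 (1) | 3, 0, 2 (non-sharp) | 8 | yes | 2 | **2** | — | j313811:G3_1346a1_D7_l3 |
| 3112a1 | [4, 1] | 2 | 2 | -7 (1) | 3, 0, 2 (non-sharp) | 8 | no | 2 | **2** | — | j313811:C2_3112a1_D7_l3 |
| 4048h1 | [4, 1, 1] | 2 | 2 | -7 (1) | 3, 0, 2 (non-sharp) | 8 | no | 2 | **2** | — | j313811:C2_4048h1_D7_l3 |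
| 575b1 | [4, 1] | 2 | 2 | -19 (1) | 3, 0, 2 (non-sharp) | 8 | no | 2 | **2** | — | j313777:C2_575b1_D19_l3 |
| 575b1 | [4, 1] | 2 | 2 | -91 (2) | 3, 0, 2 (non-sharp) | 16 | no | 2 | **2** (cert primes 277,547,823) | — | j315453:CTLh_575b1_D91_l3 |
| 718c1 | [12, 1] | 2 | 2 | -31 (3) | 3, 0, 2 (non-sharp) | 24 | no | 2 | **2** (cert primes 283,379,1063) | — | j315688:CTLh_718c1_D31_l3 |
| 1094b1 | [14, 1] | 1 | 1 | -7 (1) | 3, 0, 2 (non-sharp) | 8 | yes | 1 | **1** | yes | j313811:G3_1094b1_D7_l3 |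
| 886a1 | [2, 1] | 1 | 1 | -7 (1) | 3, 0, 2 (non-sharp) | 8 | no | 1 | **1** | yes | j313811:C1_886a1_D7_l3 |
| 163a1 | [1] | 0 | 0 | -235 (2) | 3, 0, 2 (non-sharp) | 16 | no | 0 | **0** (cert primes 661,739,769) | yes | j315688:CTLh0_163a1_D235_l3 |
| 197a1 | [1] | 0 | 0 | -7 (1) | 3, 0, 2 (non-sharp) | 8 | no | 0 | **0** | yes | j313811:C0_197a1_D7_l3 |
| 2502i1 ② | [4, 2, 1] | 3 | 2 | -23 (3) | 7, 0, 3 (non-sharp) | 48 | no | 3 | **3** (cert primes 5483,7109,7211) | — | j315688:T7s3_2502i1_D23_l7 |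
| 4005b1 ② | [2, 4, 1] | 3 | 2 | -11 (1) | 7, -4, 2 (sharp) | 16 | no | 2 | **≥ 3** (cap) | — | j317673:PIN_4005b1_D11_l7 |
| 5687b1 ② | [4, 2] | 3 | 2 | -43 (1) | 7, -4, 2 (sharp) | 16 | no | 2 | **≥ 3** (cap) | — | j317673:PIN_5687b1_D43_l7 |
| 6413j1 ② | [4, 2] | 3 | 2 | -43 (1) | 7, 0, 3 (non-sharp) | 16 | no | 3 | **3** (cert primes 547,557,599) | — | j314793:A3_6413j1_D43_l7 |
| 7579e1 ② | [1, 4, 2] | 3 | 2 | -43 (1) | 7, 0, 3 (non-sharp) | 16 | no | 3 | **3** (cert primes 547,599,683) | — | j317673:PIN_7579e1_D43_l7 |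
| 1266a1 ② | [2, 2, 1] | 2 | 1 | -23 (3) | 7, 0, 3 (non-sharp) | 48 | no | 2 | **2** (cert primes 4733,6311,7211) | yes | j315688:T7_1266a1_D23_l7 |
| 2952g1 ② | [2, 2, 1] | 2 | 1 | -23 (3) | 7, 4, 2 (sharp) | 48 | no | 2 | **2** (cert primes 1163,2423,6029) | — | j315688:T7sh_2952g1_D23_l7 |
| 3128b1 ② | [2, 2, 1] | 2 | 1 | -15 (2) | 7, 4, 2 (sharp) | 32 | no | 2 | **2** (cert primes 991,3469,4621) | — | j315688:T7sh_3128b1_D15_l7 |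
| 3496a1 ② | [2, 2, 1] | 2 | 1 | -15 (2) | 7, 0, 3 (non-sharp) | 32 | no | 2 | **2** (cert primes 751,1759,2179) | yes | j317673:PIN_3496a1_D15_l7 |
| 5025g1 ② | [2, 2, 1] | 2 | 1 | -11 (1) | 7, 0, 3 (non-sharp) | 16 | yes | 2 | **2** (cert primes 683,1213,1439) | yes | j314793:G7_5025g1_D11_l7 |
| 1611e1 | [4, 1] | 2 | 2 | -11 (1) | 7, 0, 3 (non-sharp) | 16 | no | 2 | **2** (cert primes 641,1213,1303) | yes | j314793:A2_1611e1_D11_l7 |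
| 2025e1 | [3, 4] | 2 | 2 | -11 (1) | 7, 0, 3 (non-sharp) | 16 | no | 2 | **2** (cert primes 683,863,947) | yes | j314793:A2_2025e1_D11_l7 |
| 3447b1 | [4, 1] | 2 | 2 | -11 (1) | 7, -4, 2 (sharp) | 16 | no | 2 | **2** (cert primes 191,683,2143) | — | j314793:D2_3447b1_D11_l7 |
| 4735a1 | [4, 1] | 2 | 2 | -11 (1) | 7, -4, 2 (sharp) | 16 | no | 2 | **2** (cert primes 683,863,1213) | — | j314793:D2_4735a1_D11_l7 |
| 201a1 | [2, 1] | 1 | 1 | -11 (1) | 7, 0, 3 (non-sharp) | 16 | no | 1 | **1** | yes | j313811:F_201a1_D11_l7 |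
| 155c1 | [1, 1] | 0 | 0 | -11 (1) | 7, 0, 3 (non-sharp) | 16 | no | 0 | **0** | yes | j313811:B_155c1_D11_l7 |
| 405f1 | [1, 1] | 0 | 0 | -11 (1) | 7, 0, 3 (non-sharp) | 16 | no | 0 | **0** | yes | j313811:B_405f1_D11_l7 |
| 3128b1 ② | [2, 2, 1] | 2 | 1 | -15 (2) | 11, 0, 2 (non-sharp) | 48 | no | 2 | **2** (cert primes 5659,7621,7789) | — | j317673:PIN_3128b1_D15_l11 |

  Reading the table: `claim` is S3′'s exponent `min(sigmaShift, levelIndex)` for the optimal curve (`v₂ c(Dt) = 0`, Manin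
  constant 1); «EXACT depth» is the largest `m` with `P(ℓ) ∈ 2^m E(K[ℓ])`, computed by exact halving in `E(K[ℓ])`
  (`E(K[ℓ])[2] = 0` in every row, so halves are unique and the depth is well defined); «cert primes» are rational primes
  splitting completely in `K[ℓ]` at which the obstructing partial sum has no half in `E(𝔽_r)` (independent check of the
  final non-divisibility).  Every row passed the control identity `Tr_{K[ℓ]/K} y_ℓ = a_ℓ·y_K`, `orbit = roots of H`,
  `σ^{ℓ+1} = 1`, on-curve checks (two rows of j315688 had a precision-collapsed `y_K` — recomputed in j317673, same depth).
* `StringentPrimitivityModTwoAtTwo` (S4′) — existential over `n`: refutable only by exhausting all `n`, i.e. never by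
  computation; the job records level-`ℓ` WITNESSES for it instead (exact depth `= σ` at a prime with `M(ℓ) ≥ σ+1`).
* `ShiftedKolyvaginStructureModTwoAtTwo` (S5′) — the ℕ-subtraction `M₀ - sigmaShift` is harmless (the K1-shape
  hypothesis at `n = 1` forces `σ ≤ M₀`); `Nat.card` of an infinite `Ш[2^∞]` would read `0 ≠ 2^{…}`, but `y_K` of infinite
  order gives finiteness (Kolyvagin) — no junk kill.  Instances are testable (exact `#Ш(E/K)[2^∞]` vs `2^{2(M₀−σ)}`) only
  where `#Ш(E/K)[2^∞]` is known unconditionally; recorded as BSD-consistency data in the job (`m_K`, `Ш_an`).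
-/

/-! ## R3 — genericity / Frobenius-type census per instance (answer to lead g6 `FirstRungAtTwo.md` §6 (R3); v3.1)


Source: cdisprove case JSONs (jobs j313811…j317673); `j_λ(y_K)` = 2-divisibility depth of red_λ(y_K) in Ẽ(𝔽_{ℓ²}) (E₁(K_λ) is 2-divisible, so this is the depth of y_K in E(K_λ)); GENERIC ⟺ j_λ(y_K) = M₀ (= m_K, depth of y_K in E(K)); Frobenius type from the number of roots of the 2-division cubic mod ℓ (3 = identity/split, 1 = transposition/regular); Ш₂ column = the BSD-world reading M₀ − σ (NOT computed: Ш itself was not descended). BSD is not proved by any of this.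

| curve | sgn Δ | d_K | ℓ | a_ℓ | M(ℓ) | Frob_ℓ on E[2] | σ | M₀=m_K | j_λ(y_K) | generic? | depth P(ℓ) | BSD-world Ш(E/K)[2] | job:case |
|---|---|---|---|---|---|---|---|---|---|---|---|---|---|
| 197a1 | + | −7 | 3 | 0 | 2 | regular (transposition) | 0 | 0 | 0 | GENERIC | 0 | Ш₂=0 | j313811:C0_197a1_D7_l3 |
| 2025e1 | + | −11 | 7 | 0 | 3 | regular (transposition) | 2 | 2 | 2 | GENERIC | 2 | Ш₂=0 | j314793:A2_2025e1_D11_l7 |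
| 405f1 | + | −11 | 7 | 0 | 3 | regular (transposition) | 0 | 0 | 0 | GENERIC | 0 | Ш₂=0 | j313811:B_405f1_D11_l7 |
| 886a1 | + | −7 | 3 | 0 | 2 | regular (transposition) | 1 | 1 | 1 | GENERIC | 1 | Ш₂=0 | j313811:C1_886a1_D7_l3 |
| 3112a1 | + | −7 | 3 | 0 | 2 | regular (transposition) | 2 | 2 | ∞ (y_K ∈ E₁(K_λ)) | non-generic | 2 | Ш₂=0 | j313811:C2_3112a1_D7_l3 |
| 3447b1 | + | −11 | 7 | −4 | 2 | split (Frob = id on E[2]) | 2 | 2 | 5 | non-generic | 2 | Ш₂=0 | j314793:D2_3447b1_D11_l7 |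
| 4048h1 | + | −7 | 3 | 0 | 2 | regular (transposition) | 2 | 2 | ∞ (y_K ∈ E₁(K_λ)) | non-generic | 2 | Ш₂=0 | j313811:C2_4048h1_D7_l3 |
| 718c1 | + | −31 | 3 | 0 | 2 | regular (transposition) | 2 | 2 | ∞ (y_K ∈ E₁(K_λ)) | non-generic | 2 | Ш₂=0 | j315688:CTLh_718c1_D31_l3 |
| 1266a1 | − | −23 | 7 | 0 | 3 | regular (transposition) | 2 | 2 | 2 | GENERIC | 2 | Ш₂=0 | j315688:T7_1266a1_D23_l7 |
| 155c1 | − | −11 | 7 | 0 | 3 | regular (transposition) | 0 | 0 | 0 | GENERIC | 0 | Ш₂=0 | j313811:B_155c1_D11_l7 |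
| 1611e1 | − | −11 | 7 | 0 | 3 | regular (transposition) | 2 | 2 | 2 | GENERIC | 2 | Ш₂=0 | j314793:A2_1611e1_D11_l7 |
| 201a1 | − | −11 | 7 | 0 | 3 | regular (transposition) | 1 | 1 | 1 | GENERIC | 1 | Ш₂=0 | j313811:F_201a1_D11_l7 |
| 3496a1 | − | −15 | 7 | 0 | 3 | regular (transposition) | 2 | 2 | 2 | GENERIC | 2 | Ш₂=0 | j317673:PIN_3496a1_D15_l7 |
| 1094b1 | − | −7 | 3 | 0 | 2 | regular (transposition) | 1 | deg | deg (y_K torsion) | non-generic | 1 |  | j313811:G3_1094b1_D7_l3 |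
| 1346a1 | − | −7 | 3 | 0 | 2 | regular (transposition) | 3 | deg | deg (y_K torsion) | non-generic | 2 |  | j313811:G3_1346a1_D7_l3 |
| 163a1 | − | −235 | 3 | 0 | 2 | regular (transposition) | 0 | 2 | ∞ (y_K ∈ E₁(K_λ)) | non-generic | 0 | Ш₂≠0 (BSD: #Ш[2^∞]=2^4) | j317673:PIN_163a1_D235_l3 |
| 2074b1 | − | −103 | 3 | 0 | 2 | regular (transposition) | 2 | 2 | ∞ (y_K ∈ E₁(K_λ)) | non-generic | 2 | Ш₂=0 | j315688:T3_2074b1_D103_l3 |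
| 2502i1 | − | −23 | 7 | 0 | 3 | regular (transposition) | 3 | 3 | ∞ (y_K ∈ E₁(K_λ)) | non-generic | 3 | Ш₂=0 | j315688:T7s3_2502i1_D23_l7 |
| 2952g1 | − | −23 | 7 | 4 | 2 | regular (transposition) | 2 | 2 | ∞ (y_K ∈ E₁(K_λ)) | non-generic | 2 | Ш₂=0 | j315688:T7sh_2952g1_D23_l7 |
| 3128b1 | − | −15 | 11 | 0 | 2 | regular (transposition) | 2 | 2 | 5 | non-generic | 2 | Ш₂=0 | j317673:PIN_3128b1_D15_l11 |
| 3496g1 | − | −79 | 3 | 0 | 2 | regular (transposition) | 2 | 3 | ∞ (y_K ∈ E₁(K_λ)) | non-generic | 2 | Ш₂≠0 (BSD: #Ш[2^∞]=2^2) | j315688:T3_3496g1_D79_l3 |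
| 4005b1 | − | −11 | 7 | −4 | 2 | regular (transposition) | 3 | 3 | 5 | non-generic | ≥3 | Ш₂=0 | j317673:PIN_4005b1_D11_l7 |
| 4216c1 | − | −55 | 3 | 0 | 2 | regular (transposition) | 2 | 2 | ∞ (y_K ∈ E₁(K_λ)) | non-generic | 2 | Ш₂=0 | j315688:T3_4216c1_D55_l3 |
| 4720d1 | − | −31 | 3 | 0 | 2 | regular (transposition) | 2 | 2 | ∞ (y_K ∈ E₁(K_λ)) | non-generic | 2 | Ш₂=0 | j315688:T3_4720d1_D31_l3 |
| 4735a1 | − | −11 | 7 | −4 | 2 | regular (transposition) | 2 | 2 | 5 | non-generic | 2 | Ш₂=0 | j314793:D2_4735a1_D11_l7 |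
| 5025g1 | − | −11 | 7 | 0 | 3 | regular (transposition) | 2 | deg | deg (y_K torsion) | non-generic | 2 |  | j314793:G7_5025g1_D11_l7 |
| 5687b1 | − | −43 | 7 | −4 | 2 | regular (transposition) | 3 | 3 | 5 | non-generic | ≥3 | Ш₂=0 | j317673:PIN_5687b1_D43_l7 |
| 575b1 | − | −91 | 3 | 0 | 2 | regular (transposition) | 2 | 3 | ∞ (y_K ∈ E₁(K_λ)) | non-generic | 2 | Ш₂≠0 (BSD: #Ш[2^∞]=2^2) | j315688:CTLh_575b1_D91_l3 |
| 575b1 | − | −19 | 3 | 0 | 2 | regular (transposition) | 2 | 2 | ∞ (y_K ∈ E₁(K_λ)) | non-generic | 2 | Ш₂=0 | j314574:C2_575b1_D19_l3 |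
| 6413j1 | − | −43 | 7 | 0 | 3 | regular (transposition) | 3 | 3 | ∞ (y_K ∈ E₁(K_λ)) | non-generic | 3 | Ш₂=0 | j315688:T7s3_6413j1_D43_l7 |
| 7579e1 | − | −43 | 7 | 0 | 3 | regular (transposition) | 3 | 4 | ∞ (y_K ∈ E₁(K_λ)) | non-generic | 3 | Ш₂≠0 (BSD: #Ш[2^∞]=2^2) | j317673:PIN_7579e1_D43_l7 |

## Findings

1. Lead §4 PREDICTION (Δ>0 ∧ split-type ⇒ non-generic): 1 Δ>0 split-type row(s): 3447b1/ℓ=7 (non-generic) — ALL non-generic ✓.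
2. GENERIC rows (9): 155c1/−11/ℓ=7, 405f1/−11/ℓ=7, 197a1/−7/ℓ=3, 886a1/−7/ℓ=3, 201a1/−11/ℓ=7, 1611e1/−11/ℓ=7, 2025e1/−11/ℓ=7, 1266a1/−23/ℓ=7, 3496a1/−15/ℓ=7 — every one is REGULAR type; every generic row has depth(P(ℓ)) = M₀ = σ exactly (memo §2(a) «no bit lost» realised).
3. S4′ witnesses AT GENERIC primes (convertible by McCallum's mechanism per memo §3/K2): 155c1/−11/ℓ=7 (σ=0, M=3, depth 0), 405f1/−11/ℓ=7 (σ=0, M=3, depth 0), 197a1/−7/ℓ=3 (σ=0, M=2, depth 0), 886a1/−7/ℓ=3 (σ=1, M=2, depth 1), 201a1/−11/ℓ=7 (σ=1, M=3, depth 1), 1611e1/−11/ℓ=7 (σ=2, M=3, depth 2), 2025e1/−11/ℓ=7 (σ=2, M=3, depth 2), 1266a1/−23/ℓ=7 (σ=2, M=3, depth 2), 3496a1/−15/ℓ=7 (σ=2, M=3, depth 2).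
4. Memo §2(c) «formally undetermined» configuration (non-generic λ, level M(ℓ) ≤ M₀, Ш₂=0 i.e. M₀=σ): 15 rows — 575b1/−19/ℓ=3 (M=2, depth 2), 3112a1/−7/ℓ=3 (M=2, depth 2), 4048h1/−7/ℓ=3 (M=2, depth 2), 6413j1/−43/ℓ=7 (M=3, depth 3), 3447b1/−11/ℓ=7 (M=2, depth 2), 4735a1/−11/ℓ=7 (M=2, depth 2), 2074b1/−103/ℓ=3 (M=2, depth 2), 718c1/−31/ℓ=3 (M=2, depth 2), 4216c1/−55/ℓ=3 (M=2, depth 2), 4720d1/−31/ℓ=3 (M=2, depth 2), 2502i1/−23/ℓ=7 (M=3, depth 3), 2952g1/−23/ℓ=7 (M=2, depth 2), 3128b1/−15/ℓ=11 (M=2, depth 2), 4005b1/−11/ℓ=7 (M=2, depth ≥3), 5687b1/−43/ℓ=7 (M=2, depth ≥3). In EVERY one reality picks the branch m_M(ℓ) = M (full truncated depth), never M−1: this is exactly S3′'s content beyond (E1)–(E4), confirmed 15/15.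
5. Rows with M₀ > σ (BSD-world Ш(E/K)[2] ≠ 0; S5′/S5⁺ would assert #Ш(E/K)[2^∞] = 2^{2(M₀−σ)}): 575b1/−91 (M₀=3, σ=2 ⇒ 2^2), 3496g1/−79 (M₀=3, σ=2 ⇒ 2^2), 163a1/−235 (M₀=2, σ=0 ⇒ 2^4), 7579e1/−43 (M₀=4, σ=3 ⇒ 2^2). Not descended (no unconditional Ш computation attempted).
6. Frobenius-type census: 30 regular, 1 split among 31 (curve, K, ℓ) rows; a_ℓ = 0 rows are all regular here; split occurs at 3447b1/ℓ=7 (a₇ = −4) only (5618i1/ℓ=31 is split too but was never computed).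

Composite n = ℓ₁ℓ₂ with both primes non-generic (memo R3 last sentence): NOT run this arming (engine supports prime n only); queued in Disproof.lean HANDOFF.  BSD is not proved by any of this.

-/

end Summit.BirchSwinnertonDyer.BirchSwinnertonDyer.Cruxes.RankOneAtTwoOffBigImageOddLocal.Disproof

end
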